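import Mathlib
import HarnessLib
import Literature.Probability.Distributions.GaussianWidthStatDist
import Summits.Ventures.LatticeQCDFlow.Exactness.NCMCGeneralSpaceReplicaTStatisticStudent

/-!
# Many replicas: as `R → ∞` the Student-ratio coverage tends to the normal one — under `N(0,1)^{⊗ℕ}`, `P(|z₀| ≤ q √((Σ_{r=1}^{n} z_r²)/n)) → N(0,1)([−q, q])`

HONEST FRAMING: exact (Metropolis-corrected) sampling algorithms for lattice gauge theory;
figures of merit are autocorrelation/cost numbers at stated couplings and volumes; no
continuum-physics claim.

Venture `LatticeQCDFlow` (cell pub-lqcd), topic `Exactness`; FANOUT row 13 (`eng-snf`, GEN-24).  NEW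
WORK of the cell against Mathlib (the infinite product measure `Measure.infinitePi`,
`iIndepFun_infinitePi`, `measurePreserving_eval_infinitePi`, Etemadi's strong law `strong_law_ae`,
dominated convergence) and the tree's
`Literature.Probability.Distributions.integral_sq_gaussianReal_zero`; not a published result (the
convergence of Student's `t_ν` to the normal law is NAMED ONLY); no definition is introduced.

WHY (row 13).  GEN-24 identified the universal limiting coverage of the engine's replica-`t` /
jackknife bars as the Student-ratio probability
`L_R(q) = N(0,1)^{⊗R}{|z_{r₀}| ≤ q √((Σ_{r≠r₀} z_r²)/(R−1))}` (`…ReplicaTStatisticStudent`), computed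
`L_2` (`…TwoReplicas`) and proved `L_R(q) ≤ N(0,1)([−q,q])` for every `R` (`…Undercoverage`).
This file adds the large-`R` end: realising all replicas at once as coordinates of ONE infinite
product `N(0,1)^{⊗ℕ}`, the ratio's denominator `√((Σ_{r=1}^{n} z_r²)/n) → 1` almost surely (strong
law), hence the coverage with `n + 1` replicas, `P(|z₀| ≤ q √((Σ_{r=1}^{n} z_r²)/n))`, tends to the
normal coverage `N(0,1)([−q, q])`: with many replicas the normal quantile becomes (asymptotically in
`R`) calibrated.  The identification of the `n`-th term with `L_{n+1}(q)` is one marginalisation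
(`Measure.infinitePi_map_restrict`), done in §3 with the replicas indexed by `↥(Finset.range (n+2))`.

## Content
* `ae_tendsto_mean_sq_infinitePi_gaussianReal` (§1) — under `N(0,1)^{⊗ℕ}`:
  `(1/n) Σ_{r<n} z_{r+1}² → 1` almost surely (strong law for the i.i.d. squares).
* **`tendsto_infinitePi_measure_abs_eval_le_mul_sqrt_mean_sq`** (§2) — for every `q ≥ 0`:
  `N(0,1)^{⊗ℕ}{z | |z 0| ≤ q √((Σ_{r<n} z_{r+1}²)/n)} → N(0,1)([−q, q])` as `n → ∞`.
* **`tendsto_replicaT_coverage_atTop_card`** (§3) — in the tree's vocabulary (GEN-23 K3's `L_R(q)`,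
  via GEN-24 S and `Measure.infinitePi_map_restrict`): with `R = n + 2` replicas indexed by
  `↥(Finset.range (n+2))`, `L_R(q) → N(0,1)([−q, q])` as `n → ∞`;
  `pi_gaussianReal_measure_abs_tStat_le_relabel` (§4: `L` is invariant under relabeling `ι ≃ ι'`),
  **`tendsto_replicaT_coverage_atTop_fin`** — the same with replicas indexed by `Fin (n + 2)`.

NOT CLAIMED: a rate in `R`; monotonicity in `R`; anything numerical.
-/

namespace Summit.Ventures.LatticeQCDFlow.Exactness.GeneralNCMC

open MeasureTheory ProbabilityTheory Set Filter Topology Finset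
open scoped ENNReal NNReal Topology

section ManyReplicas

/-! ## §1 The strong law for the squares -/

/-- Under `N(0,1)^{⊗ℕ}` the running mean of the squares of the coordinates `1, 2, …` tends to `1`
almost surely. -/
theorem ae_tendsto_mean_sq_infinitePi_gaussianReal :
    ∀ᵐ z ∂(Measure.infinitePi fun _ : ℕ => gaussianReal 0 1),
      Tendsto (fun n : ℕ => (n : ℝ)⁻¹ * ∑ r ∈ range n, z (r + 1) ^ 2) atTop (𝓝 1) := by
  set μ : Measure (ℕ → ℝ) := Measure.infinitePi fun _ : ℕ => gaussianReal 0 1 with hμ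
  -- the squares of the shifted coordinates: i.i.d., integrable, mean 1
  set X : ℕ → (ℕ → ℝ) → ℝ := fun i z => z (i + 1) ^ 2 with hX
  have hXm : ∀ i, Measurable (X i) := fun i => (measurable_pi_apply (i + 1)).pow_const 2
  have hlaw : ∀ i, μ.map (X i) = (gaussianReal 0 1).map (fun x : ℝ => x ^ 2) := by
    intro i
    rw [← Measure.infinitePi_map_eval (fun _ : ℕ => gaussianReal 0 1) (i + 1),
      Measure.map_map (by fun_prop : Measurable fun x : ℝ => x ^ 2) (measurable_pi_apply _), hμ]
    rfl
  have hident : ∀ i, IdentDistrib (X i) (X 0) μ μ := fun i =>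
    ⟨(hXm i).aemeasurable, (hXm 0).aemeasurable, by rw [hlaw i, hlaw 0]⟩
  have hindep : Pairwise (Function.onFun (· ⟂ᵢ[μ] ·) X) := by
    have hi : iIndepFun (fun i (z : ℕ → ℝ) => z i ^ 2) μ :=
      iIndepFun_infinitePi (P := fun _ : ℕ => gaussianReal 0 1) (X := fun _ (x : ℝ) => x ^ 2)
        fun _ => by fun_prop
    intro i j hij
    exact hi.indepFun (by omega : i + 1 ≠ j + 1)
  have hint : Integrable (X 0) μ := by
    have h := (measurePreserving_eval_infinitePi (fun _ : ℕ => gaussianReal 0 1) 1).integrable_comp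
      (g := fun x : ℝ => x ^ 2) (by fun_prop : Measurable fun x : ℝ => x ^ 2).aestronglyMeasurable
    have hm := memLp_id_gaussianReal (μ := 0) (v := 1) 2
    exact h.2 ((memLp_two_iff_integrable_sq hm.1).1 hm)
  have hmean : μ[X 0] = 1 := by
    have h := integral_map (μ := μ) (measurable_pi_apply 1).aemeasurable
      (f := fun x : ℝ => x ^ 2) (by fun_prop)
    rw [hμ, Measure.infinitePi_map_eval,
      Literature.Probability.Distributions.integral_sq_gaussianReal_zero, NNReal.coe_one] at h
    rw [hX]
    simp only [zero_add]
    rw [← hμ] at h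
    exact h.symm
  have h := strong_law_ae X hint hindep hident
  rw [hmean] at h
  filter_upwards [h] with z hz
  simpa [smul_eq_mul] using hz

/-! ## §2 The coverage with many replicas -/

/-- **AS `R → ∞` THE STUDENT-RATIO COVERAGE TENDS TO THE NORMAL COVERAGE**: for every `q ≥ 0`,
`N(0,1)^{⊗ℕ}{z | |z 0| ≤ q √((Σ_{r<n} z_{r+1}²)/n)} → N(0,1)([−q, q])`. -/
theorem tendsto_infinitePi_measure_abs_eval_le_mul_sqrt_mean_sq {q : ℝ} (hq : 0 ≤ q) :
    Tendsto (fun n : ℕ => (Measure.infinitePi fun _ : ℕ => gaussianReal 0 1)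
        {z : ℕ → ℝ | |z 0| ≤ q * Real.sqrt ((n : ℝ)⁻¹ * ∑ r ∈ range n, z (r + 1) ^ 2)})
      atTop (𝓝 ((gaussianReal 0 1) (Icc (-q) q))) := by
  set μ : Measure (ℕ → ℝ) := Measure.infinitePi fun _ : ℕ => gaussianReal 0 1 with hμ
  -- the limit event and its probability
  have hlim : μ {z : ℕ → ℝ | |z 0| ≤ q} = (gaussianReal 0 1) (Icc (-q) q) := by
    have : {z : ℕ → ℝ | |z 0| ≤ q} = (fun z : ℕ → ℝ => z 0) ⁻¹' Icc (-q) q := by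
      ext z; simp [abs_le]
    rw [this, ← Measure.map_apply (measurable_pi_apply 0) measurableSet_Icc, hμ,
      Measure.infinitePi_map_eval]
  rw [← hlim]
  -- measurability of the events
  have hWm : ∀ n : ℕ, Measurable fun z : ℕ → ℝ =>
      q * Real.sqrt ((n : ℝ)⁻¹ * ∑ r ∈ range n, z (r + 1) ^ 2) := fun n => by
    have : ∀ r, Measurable fun z : ℕ → ℝ => z r := fun r => measurable_pi_apply r
    fun_prop
  have hA : ∀ n : ℕ, MeasurableSet {z : ℕ → ℝ |
      |z 0| ≤ q * Real.sqrt ((n : ℝ)⁻¹ * ∑ r ∈ range n, z (r + 1) ^ 2)} := fun n =>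
    measurableSet_le (measurable_pi_apply 0).abs (hWm n)
  have hA0 : MeasurableSet {z : ℕ → ℝ | |z 0| ≤ q} :=
    measurableSet_le (measurable_pi_apply 0).abs measurable_const
  -- the boundary `{|z 0| = q}` is null
  have hnull : μ {z : ℕ → ℝ | |z 0| = q} = 0 := by
    have hsub : {z : ℕ → ℝ | |z 0| = q} ⊆ (fun z : ℕ → ℝ => z 0) ⁻¹' {q, -q} := by
      intro z hz
      simp only [mem_setOf_eq] at hz
      simp only [Set.mem_preimage, Set.mem_insert_iff, Set.mem_singleton_iff]
      rcases abs_eq (hq) |>.1 hz with h | h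
      · exact Or.inl h
      · exact Or.inr h
    refine measure_mono_null hsub ?_
    rw [← Measure.map_apply (measurable_pi_apply 0) (by measurability), hμ,
      Measure.infinitePi_map_eval]
    haveI : NullSingletonClass (gaussianReal (0 : ℝ) (1 : ℝ≥0)) :=
      nullSingletonClass_gaussianReal one_ne_zero
    exact (Set.toFinite {q, -q}).measure_zero _
  -- indicators converge almost everywhere
  have hae : ∀ᵐ z ∂μ, Tendsto (fun n : ℕ => ({z : ℕ → ℝ |
      |z 0| ≤ q * Real.sqrt ((n : ℝ)⁻¹ * ∑ r ∈ range n, z (r + 1) ^ 2)}).indicator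
        (1 : (ℕ → ℝ) → ℝ≥0∞) z) atTop
      (𝓝 (({z : ℕ → ℝ | |z 0| ≤ q}).indicator (1 : (ℕ → ℝ) → ℝ≥0∞) z)) := by
    have hne : ∀ᵐ z ∂μ, |z 0| ≠ q := by
      rw [ae_iff]; simpa only [not_not] using hnull
    filter_upwards [ae_tendsto_mean_sq_infinitePi_gaussianReal, hne] with z hz hzq
    have hW : Tendsto (fun n : ℕ => q * Real.sqrt ((n : ℝ)⁻¹ * ∑ r ∈ range n, z (r + 1) ^ 2))
        atTop (𝓝 q) := by
      have := (Real.continuous_sqrt.tendsto 1).comp hz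
      rw [Real.sqrt_one] at this
      simpa using this.const_mul q
    rcases lt_or_gt_of_ne hzq with hlt | hgt
    · -- eventually inside
      have hev : ∀ᶠ n : ℕ in atTop,
          |z 0| ≤ q * Real.sqrt ((n : ℝ)⁻¹ * ∑ r ∈ Finset.range n, z (r + 1) ^ 2) :=
        (hW.eventually (lt_mem_nhds hlt)).mono fun n hn => hn.le
      simp only [indicator_of_mem (show z ∈ {z : ℕ → ℝ | |z 0| ≤ q} from hlt.le)]
      refine (tendsto_congr' (hev.mono fun n hn => ?_)).2 tendsto_const_nhds
      exact indicator_of_mem (show z ∈ {z : ℕ → ℝ | |z 0| ≤ q * _} from hn) _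
    · -- eventually outside
      have hev : ∀ᶠ n : ℕ in atTop,
          ¬ |z 0| ≤ q * Real.sqrt ((n : ℝ)⁻¹ * ∑ r ∈ Finset.range n, z (r + 1) ^ 2) :=
        (hW.eventually (gt_mem_nhds hgt)).mono fun n hn => not_le.2 hn
      simp only [indicator_of_notMem (show z ∉ {z : ℕ → ℝ | |z 0| ≤ q} from not_le.2 hgt)]
      refine (tendsto_congr' (hev.mono fun n hn => ?_)).2 tendsto_const_nhds
      exact indicator_of_notMem (show z ∉ {z : ℕ → ℝ | |z 0| ≤ q * _} from hn) _
  -- dominated convergence for the indicators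
  have key := tendsto_lintegral_of_dominated_convergence (μ := μ) (bound := fun _ => (1 : ℝ≥0∞))
    (F := fun (n : ℕ) (z : ℕ → ℝ) => ({z : ℕ → ℝ |
      |z 0| ≤ q * Real.sqrt ((n : ℝ)⁻¹ * ∑ r ∈ range n, z (r + 1) ^ 2)}).indicator 1 z)
    (f := fun z => ({z : ℕ → ℝ | |z 0| ≤ q}).indicator 1 z)
    (fun n => (measurable_one.indicator (hA n))) (fun n => Eventually.of_forall fun z =>
      Set.indicator_apply_le' (fun _ => le_rfl) (fun _ => zero_le_one)) (by simp) hae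
  simp only [lintegral_indicator_one (hA _), lintegral_indicator_one hA0] at key
  exact key

/-! ## §3 In the tree's vocabulary: `L_R(q) → N(0,1)([−q, q])` along `R = n + 2` -/

/-- The sum of squares of the other coordinates, read on the first `n + 2` coordinates of `ℕ`. -/
theorem sum_sq_erase_restrict_range (n : ℕ) (x : ℕ → ℝ) :
    ∑ r ∈ (univ : Finset ↥(Finset.range (n + 2))).erase ⟨0, by simp⟩,
        ((Finset.range (n + 2)).restrict x) r ^ 2
      = ∑ r ∈ Finset.range (n + 1), x (r + 1) ^ 2 := by
  have hmem : (⟨0, by simp⟩ : ↥(Finset.range (n + 2))) ∈ (univ : Finset ↥(Finset.range (n + 2))) :=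
    mem_univ _
  rw [Finset.sum_erase_eq_sub hmem]
  simp only [Finset.restrict]
  rw [show (∑ r : ↥(Finset.range (n + 2)), x (↑r : ℕ) ^ 2) = ∑ k ∈ Finset.range (n + 2), x k ^ 2 from
    Finset.sum_coe_sort (Finset.range (n + 2)) (fun k => x k ^ 2), Finset.sum_range_succ']
  ring

/-- **`L_R(q) → N(0,1)([−q, q])` AS `R → ∞`** — with `R = n + 2` replicas indexed by the first
`n + 2` natural numbers: the universal limiting coverage of the replica-`t` / jackknife bar
(GEN-23 K3/K4/I, GEN-24 J/J2/…) tends to the nominal normal coverage. -/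
theorem tendsto_replicaT_coverage_atTop_card {q : ℝ} (hq : 0 ≤ q) :
    Tendsto (fun n : ℕ => (Measure.pi fun _ : ↥(Finset.range (n + 2)) => gaussianReal 0 1)
        {z : ↥(Finset.range (n + 2)) → ℝ | |(∑ r, z r) / Fintype.card ↥(Finset.range (n + 2))
          / Real.sqrt ((∑ r, (z r - (∑ r', z r') / Fintype.card ↥(Finset.range (n + 2))) ^ 2)
            / ((Fintype.card ↥(Finset.range (n + 2)) : ℝ)
              * (Fintype.card ↥(Finset.range (n + 2)) - 1)))| ≤ q})
      atTop (𝓝 ((gaussianReal 0 1) (Icc (-q) q))) := by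
  -- shift F7's statement by one (`n + 1` squares)
  have hlim := (tendsto_infinitePi_measure_abs_eval_le_mul_sqrt_mean_sq hq).comp
    (tendsto_add_atTop_nat 1)
  refine hlim.congr fun n => ?_
  simp only [Function.comp_apply]
  -- rewrite `L_{n+2}` through the Student-ratio form (GEN-24 S) and marginalise the infinite product
  haveI : Nontrivial ↥(Finset.range (n + 2)) := by
    refine ⟨⟨⟨0, by simp⟩, ⟨1, by simp⟩, ?_⟩⟩
    simp
  rw [pi_gaussianReal_measure_abs_tStat_le_eq_studentRatio (⟨0, by simp⟩ : ↥(Finset.range (n + 2)))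
    one_ne_zero q]
  have hcard : (Fintype.card ↥(Finset.range (n + 2)) : ℝ) - 1 = (n + 1 : ℕ) := by
    rw [Fintype.card_coe, Finset.card_range]; push_cast; ring
  have hA : MeasurableSet {z : ↥(Finset.range (n + 2)) → ℝ |
      |z ⟨0, by simp⟩| ≤ q * Real.sqrt ((∑ r ∈ univ.erase ⟨0, by simp⟩, z r ^ 2)
        / ((Fintype.card ↥(Finset.range (n + 2)) : ℝ) - 1))} := by
    have hc : ∀ r, Measurable fun z : ↥(Finset.range (n + 2)) → ℝ => z r :=
      fun r => measurable_pi_apply r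
    exact measurableSet_le (hc _).abs (by fun_prop)
  have hm := Measure.infinitePi_map_restrict (μ := fun _ : ℕ => gaussianReal 0 1)
    (I := Finset.range (n + 2))
  rw [← hm, Measure.map_apply (Finset.measurable_restrict _) hA]
  congr 1
  ext x
  simp only [Set.mem_preimage, Set.mem_setOf_eq, hcard]
  rw [sum_sq_erase_restrict_range n x]
  simp only [Finset.restrict, Nat.cast_add, Nat.cast_one]
  rw [div_eq_inv_mul]

/-! ## §4 Relabeling the replicas; the statement over `Fin (n + 2)` -/

/-- **`L_R(q)` depends on the replica labels only through their number**: for `e : ι ≃ ι'`,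
`N(0,v)^{⊗ι'}{|t| ≤ q} = N(0,v)^{⊗ι}{|t| ≤ q}`. -/
theorem pi_gaussianReal_measure_abs_tStat_le_relabel {ι ι' : Type*} [Fintype ι] [Fintype ι']
    (e : ι ≃ ι') (v : ℝ≥0) (q : ℝ) :
    (Measure.pi fun _ : ι' => gaussianReal 0 v) {z : ι' → ℝ | |(∑ r, z r) / Fintype.card ι'
        / Real.sqrt ((∑ r, (z r - (∑ r', z r') / Fintype.card ι') ^ 2)
            / ((Fintype.card ι' : ℝ) * (Fintype.card ι' - 1)))| ≤ q}
      = (Measure.pi fun _ : ι => gaussianReal 0 v) {z : ι → ℝ | |(∑ r, z r) / Fintype.card ι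
        / Real.sqrt ((∑ r, (z r - (∑ r', z r') / Fintype.card ι) ^ 2)
            / ((Fintype.card ι : ℝ) * (Fintype.card ι - 1)))| ≤ q} := by
  have hA : MeasurableSet {z : ι' → ℝ | |(∑ r, z r) / Fintype.card ι'
        / Real.sqrt ((∑ r, (z r - (∑ r', z r') / Fintype.card ι') ^ 2)
            / ((Fintype.card ι' : ℝ) * (Fintype.card ι' - 1)))| ≤ q} := by
    have hc : ∀ r : ι', Measurable fun z : ι' → ℝ => z r := fun r => measurable_pi_apply r
    refine measurableSet_le ?_ measurable_const
    fun_prop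
  rw [← (measurePreserving_piCongrLeft (fun _ : ι' => gaussianReal 0 v) e).map_eq,
    Measure.map_apply (MeasurableEquiv.measurable _) hA]
  congr 1
  ext x
  simp only [Set.mem_preimage, Set.mem_setOf_eq, MeasurableEquiv.piCongrLeft,
    MeasurableEquiv.coe_mk, Equiv.piCongrLeft_apply_eq_cast, cast_eq, Fintype.card_congr e]
  rw [Equiv.sum_comp e.symm (fun r => x r), Fintype.card_congr e.symm]
  simp_rw [Equiv.sum_comp e.symm (fun r => (x r - (∑ r', x r') / Fintype.card ι) ^ 2)]

/-- **`L_R(q) → N(0,1)([−q, q])` AS `R → ∞`, replicas indexed by `Fin R`** (`R = n + 2`). -/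
theorem tendsto_replicaT_coverage_atTop_fin {q : ℝ} (hq : 0 ≤ q) :
    Tendsto (fun n : ℕ => (Measure.pi fun _ : Fin (n + 2) => gaussianReal 0 1)
        {z : Fin (n + 2) → ℝ | |(∑ r, z r) / Fintype.card (Fin (n + 2))
          / Real.sqrt ((∑ r, (z r - (∑ r', z r') / Fintype.card (Fin (n + 2))) ^ 2)
            / ((Fintype.card (Fin (n + 2)) : ℝ) * (Fintype.card (Fin (n + 2)) - 1)))| ≤ q})
      atTop (𝓝 ((gaussianReal 0 1) (Icc (-q) q))) := by
  refine (tendsto_replicaT_coverage_atTop_card hq).congr fun n => ?_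
  have e : ↥(Finset.range (n + 2)) ≃ Fin (n + 2) :=
    (Finset.equivFin _).trans (finCongr (Finset.card_range _))
  exact (pi_gaussianReal_measure_abs_tStat_le_relabel e 1 q).symm

end ManyReplicas

end Summit.Ventures.LatticeQCDFlow.Exactness.GeneralNCMC
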